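import Literature.NumberTheory.Transcendental.PeriodsWave0
import Literature.NumberTheory.Transcendental.AperyIrrationality
import Literature.NumberTheory.Transcendental.OddZetaFinal
import HarnessLib

/-!
# Periods family, wave 0 — proofs: Hermite's theorem and `e + π` / `e π`

Sibling proof file of `PeriodsWave0.lean`. It discharges two named facts of that file:

* `Literature.NumberTheory.Transcendental.transcendental_exp_one` (**periods.S11**, Hermite 1873): `e` is transcendental
  — `transcendental_exp_one_holds`;
* `Literature.NumberTheory.Transcendental.transcendental_exp_one_add_pi_or_mul_pi` (**periods.S15**, folklore): at least
  one of `e + π`, `e π` is transcendental — `transcendental_exp_one_add_pi_or_mul_pi_holds`.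

It also records the logical neighbourhood of the two OPEN irrationality statements of **periods.S15**,
`ExpOneAddPiIrrational` (`e + π ∉ ℚ`) and `ExpOneMulPiIrrational` (`e π ∉ ℚ`), neither of which has a
proof in print ("On ne sait pas montrer non plus que les nombres `e + π` et `eπ` sont irrationnels,
bien que l'on sache qu'au moins l'un des deux est transcendant car `e` et `π` le sont"
[Rivoal2024, §4 p. 204]): both follow from the open conjecture `ExpOnePiAlgebraicIndependent`
(`expOneAddPiIrrational_of_expOnePiAlgebraicIndependent`,
`expOneMulPiIrrational_of_expOnePiAlgebraicIndependent`, via the folklore lemmas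
`irrational_add_of_algebraicIndependent`, `irrational_mul_of_algebraicIndependent`), and their
disjunction holds unconditionally (`expOneAddPiIrrational_or_expOneMulPiIrrational`, from
`transcendental_exp_one_add_pi_or_mul_pi_holds`). No `ExpOneAddPiIrrational_holds` /
`ExpOneMulPiIrrational_holds` is to be expected.

## Source and proof architecture

A. Baker, *Transcendental Number Theory* (Cambridge, 1975), Ch. 1 §2, Theorem 1.2 (p. 4):
"e is transcendental", with the Hermite–Hilbert–Hurwitz–Gordan proof: suppose
`q₀ + q₁ e + ⋯ + qₙ eⁿ = 0` with integers `qᵢ`, `q₀ ≠ 0`; put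
`f(x) = x^{p-1} (x-1)^p ⋯ (x-n)^p` for a large prime `p` and
`I(t) = ∫₀ᵗ e^{t-u} f(u) du = e^t ∑ⱼ f⁽ʲ⁾(0) − ∑ⱼ f⁽ʲ⁾(t)`; then
`J = q₀ I(0) + ⋯ + qₙ I(n)` is a non-zero integer divisible by `(p-1)!` (for `p > n`,
`p > |q₀|`), while `|J| ≤ c^p` — a contradiction for `p` large.

Mathlib (tag v4.32.0) contains exactly the analytic half of this argument, in the generality of
the Lindemann–Weierstrass theorem: `LindemannWeierstrass.exp_polynomial_approx` (file
`Mathlib/NumberTheory/Transcendental/Lindemann/AnalyticalPart.lean`, following Jacobson,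
*Basic Algebra I*, §4.12, eq. (68)) — for `f ∈ ℤ[X]` with `f(0) ≠ 0` there is `c` such that for
every prime `p > |f(0)|` there are `nₚ ∈ ℤ`, `p ∤ nₚ`, and `gₚ ∈ ℤ[X]` with
`|nₚ e^r − p gₚ(r)| ≤ c^p / (p-1)!` for every complex root `r` of `f`.
We apply it with `f = (X-1)(X-2)⋯(X-n)` (roots `1, …, n`): multiplying the relation
`∑ qₖ eᵏ = 0` by `nₚ` gives the integer `M = q₀ nₚ + p ∑ₖ qₖ gₚ(k) = −∑ₖ qₖ (nₚ eᵏ − p gₚ(k))`,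
which is non-zero because `p ∤ q₀ nₚ`, yet `|M| ≤ (∑ |qₖ|) c^p/(p-1)! < 1` for `p` large
(`FloorSemiring.tendsto_mul_pow_div_factorial_sub_atTop`). This is Baker's `J`-argument with the
divisibility bookkeeping already done inside Mathlib's lemma.

The reduction to `q₀ ≠ 0` divides out the exact power of `X` (`e ≠ 0`); the passage from `ℤ`
to `ℚ` coefficients is `IsFractionRing.isAlgebraic_iff`, and from `Complex.exp 1` to
`Real.exp 1` is `transcendental_algebraMap_iff`.

Finally (**periods.S15**): `e` and `π` are the roots of `X² − (e+π) X + e π`; if both `e + π`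
and `e π` were algebraic, `e` would be algebraic over the ring of real algebraic numbers
`Subalgebra.algebraicClosure ℚ ℝ`, hence over `ℚ` (`IsAlgebraic.restrictScalars`),
contradicting Theorem 1.2.

## Contents

* `aeval_cexp_one_ne_zero` — the core of Theorem 1.2 for `q ∈ ℤ[X]` with `q.coeff 0 ≠ 0`;
* `transcendental_int_cexp_one`, `transcendental_rat_cexp_one` — `e = exp 1 ∈ ℂ` is
  transcendental over `ℤ`, over `ℚ`;
* `transcendental_exp_one_holds`, `transcendental_exp_one_add_pi_or_mul_pi_holds`;
* `ball_rivoal.infinite_setOf_irrational_zetaValue_odd` — the printed deduction, from the Rivoal /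
  Ball–Rivoal dimension bound `ball_rivoal` (**periods.S19**, Théorème 1), of its Corollary
  `infinite_setOf_irrational_zetaValue_odd` (infinitely many `ζ(2k+1)` are irrational): the named fact
  **periods.S19**-Corollary is therefore not independent debt — once `ball_rivoal_holds` lands, its
  discharge is `ball_rivoal_holds.infinite_setOf_irrational_zetaValue_odd`.
* `infinite_setOf_irrational_zetaValue_odd_holds` — **periods.S19**-Corollary DISCHARGED unconditionally
  (infinitely many `ζ(2k+1)` are irrational), from `OddZetaFinal.setOf_irrational_zetaValue_odd_infinite`
  (the elementary Zudilin–Sprang–Fischler–Sprang–Zudilin method: `OddZetaPartialFractions`, `OddZetaSeries`,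
  `OddZetaSampling`, `OddZetaFinal`), independently of `ball_rivoal`;
* `irrational_zetaValue_three_holds` — Apéry's theorem (**periods.S18**), from `AperyIrrationality.lean`;
* `irrational_add_of_algebraicIndependent`, `irrational_mul_of_algebraicIndependent`,
  `expOneAddPiIrrational_of_expOnePiAlgebraicIndependent`,
  `expOneMulPiIrrational_of_expOnePiAlgebraicIndependent`,
  `expOneAddPiIrrational_or_expOneMulPiIrrational` — the periods.S15 neighbourhood (last section).

## References

* A. Baker, *Transcendental Number Theory*, Cambridge Univ. Press (1975),
  doi:10.1017/CBO9780511565977, Ch. 1 §2, Theorem 1.2 (p. 4). [BakerTNT1975]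
* C. Hermite, *Sur la fonction exponentielle*, C. R. Acad. Sci. Paris 77 (1873).
* N. Jacobson, *Basic Algebra I* (1974), §4.12 (the shape of Mathlib's analytic lemma).
* T. Rivoal, *Les E-fonctions et G-fonctions de Siegel*, in: Périodes et transcendance, Journées
  mathématiques X-UPS 2019, Éditions de l'École polytechnique (2024), doi:10.5802/xups.2019-03,
  §4 p. 204 (status of `e + π`, `e π`). [Rivoal2024]
-/

noncomputable section

open Complex Polynomial Finset Filter Topology
open scoped Nat

namespace Literature.NumberTheory.Transcendental

/-- **Core of Hermite's theorem** (Baker 1975, Ch. 1 Thm. 1.2, the `J`-argument): an integer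
polynomial `q` with non-zero constant coefficient does not vanish at `e = exp 1`.
Proof: apply `LindemannWeierstrass.exp_polynomial_approx` to `f = (X-1)⋯(X-n)`,
`n = deg q`; for a prime `p > max(|f(0)|, |q₀|)` with `(∑|qₖ|) c^p/(p-1)! < 1` the integer
`q₀ nₚ + p ∑ qₖ gₚ(k)` is non-zero and of absolute value `< 1`.
[cite: BakerTNT1975, Ch. 1 §2 Thm. 1.2] -/
theorem aeval_cexp_one_ne_zero (q : ℤ[X]) (h0 : q.coeff 0 ≠ 0) : aeval (cexp 1) q ≠ 0 := by
  intro hq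
  -- the relation `∑ qᵢ eⁱ = 0`, split as `q₀ + ∑_{k<n} q_{k+1} e^{k+1} = 0`
  have hsum : ∑ i ∈ range (q.natDegree + 1), (q.coeff i : ℂ) * cexp (i : ℂ) = 0 := by
    rw [← hq, aeval_eq_sum_range]
    refine sum_congr rfl fun i _ => ?_
    rw [Algebra.smul_def, eq_intCast, ← Complex.exp_nat_mul, mul_one]
  have hsum' : (q.coeff 0 : ℂ) +
      ∑ k ∈ range q.natDegree, (q.coeff (k + 1) : ℂ) * cexp ((k : ℂ) + 1) = 0 := by
    rw [sum_range_succ'] at hsum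
    push_cast [Complex.exp_zero] at hsum
    linear_combination hsum
  -- the auxiliary polynomial `f = (X-1)(X-2)⋯(X-n)`
  set n : ℕ := q.natDegree with hn
  set f : ℤ[X] := ∏ i ∈ range n, (X - C ((i : ℤ) + 1)) with hf
  have hfm : f.Monic := monic_prod_of_monic _ _ fun i _ => monic_X_sub_C _
  have hf0 : f.eval 0 ≠ 0 := by
    rw [hf, eval_prod]
    exact prod_ne_zero_iff.2 fun i _ => by
      simp only [eval_sub, eval_X, eval_C, zero_sub, ne_eq, neg_eq_zero]; omega
  have hroot : ∀ k ∈ range n, ((k : ℂ) + 1) ∈ f.aroots ℂ := by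
    intro k hk
    rw [mem_aroots]
    refine ⟨hfm.ne_zero, ?_⟩
    rw [hf, map_prod]
    exact prod_eq_zero hk (by simp)
  obtain ⟨c, hc⟩ := LindemannWeierstrass.exp_polynomial_approx f hf0
  -- choice of the prime `p`
  obtain ⟨S, hS⟩ : ∃ S : ℝ, S = ∑ k ∈ range n, |((q.coeff (k + 1) : ℤ) : ℝ)| := ⟨_, rfl⟩
  have hlim : Tendsto (fun p : ℕ => S * |c| ^ p / (p - 1)!) atTop (𝓝 0) :=
    FloorSemiring.tendsto_mul_pow_div_factorial_sub_atTop S |c| 1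
  obtain ⟨N, hN⟩ := eventually_atTop.1 (hlim.eventually_lt_const zero_lt_one)
  obtain ⟨p, hpge, hp⟩ :=
    Nat.exists_infinite_primes (N + (f.eval 0).natAbs + (q.coeff 0).natAbs + 1)
  have hpN : N ≤ p := by omega
  have hpf : (f.eval 0).natAbs < p := by omega
  have hpq : (q.coeff 0).natAbs < p := by omega
  obtain ⟨np, hndvd, gp, -, H⟩ := hc p hpf hp
  have hG : ∀ k : ℕ, aeval ((k : ℂ) + 1) gp = ((gp.eval ((k : ℤ) + 1) : ℤ) : ℂ) := by
    intro k
    have := aeval_algebraMap_apply_eq_algebraMap_eval (A := ℂ) ((k : ℤ) + 1) gp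
    simpa using this
  have H' : ∀ k ∈ range n,
      ‖(np : ℂ) * cexp ((k : ℂ) + 1) - (p : ℂ) * ((gp.eval ((k : ℤ) + 1) : ℤ) : ℂ)‖ ≤
        |c| ^ p / (p - 1)! := by
    intro k hk
    have h := H (hroot k hk)
    simp only [zsmul_eq_mul, nsmul_eq_mul, hG] at h
    exact h.trans (div_le_div_of_nonneg_right ((le_abs_self _).trans_eq (abs_pow c p))
      (Nat.cast_nonneg _))
  -- the integer `M`
  obtain ⟨M, hM⟩ : ∃ M : ℤ,
      M = q.coeff 0 * np + p * ∑ k ∈ range n, q.coeff (k + 1) * gp.eval ((k : ℤ) + 1) :=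
    ⟨_, rfl⟩
  have hM0 : M ≠ 0 := by
    intro hM0
    have hdvd : (p : ℤ) ∣ q.coeff 0 * np := by
      have e : q.coeff 0 * np =
          -(p * ∑ k ∈ range n, q.coeff (k + 1) * gp.eval ((k : ℤ) + 1)) := by
        rw [← sub_eq_zero, sub_neg_eq_add, ← hM, hM0]
      rw [e]
      exact dvd_neg.2 (dvd_mul_right _ _)
    rcases (Nat.prime_iff_prime_int.mp hp).dvd_or_dvd hdvd with h | h
    · exact absurd (Nat.le_of_dvd (Int.natAbs_pos.2 h0) (Int.natCast_dvd.1 h)) (not_le.2 hpq)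
    · exact hndvd h
  have hMC : (M : ℂ) = -∑ k ∈ range n, (q.coeff (k + 1) : ℂ) *
      ((np : ℂ) * cexp ((k : ℂ) + 1) - (p : ℂ) * ((gp.eval ((k : ℤ) + 1) : ℤ) : ℂ)) := by
    have hsplit : ∑ k ∈ range n, (q.coeff (k + 1) : ℂ) *
        ((np : ℂ) * cexp ((k : ℂ) + 1) - (p : ℂ) * ((gp.eval ((k : ℤ) + 1) : ℤ) : ℂ)) =
        (np : ℂ) * ∑ k ∈ range n, (q.coeff (k + 1) : ℂ) * cexp ((k : ℂ) + 1) -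
          (p : ℂ) * ∑ k ∈ range n, (q.coeff (k + 1) : ℂ) * ((gp.eval ((k : ℤ) + 1) : ℤ) : ℂ) := by
      rw [mul_sum, mul_sum, ← sum_sub_distrib]
      exact sum_congr rfl fun k _ => by ring
    rw [hsplit, hM]
    push_cast
    linear_combination (np : ℂ) * hsum'
  -- `1 ≤ |M| ≤ S c^p/(p-1)! < 1`
  have hnorm : ‖(M : ℂ)‖ ≤ S * |c| ^ p / (p - 1)! := by
    rw [hMC, norm_neg]
    refine (norm_sum_le _ _).trans ?_
    calc ∑ k ∈ range n, ‖(q.coeff (k + 1) : ℂ) *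
          ((np : ℂ) * cexp ((k : ℂ) + 1) - (p : ℂ) * ((gp.eval ((k : ℤ) + 1) : ℤ) : ℂ))‖
        ≤ ∑ k ∈ range n, |((q.coeff (k + 1) : ℤ) : ℝ)| * (|c| ^ p / (p - 1)!) :=
          sum_le_sum fun k hk => by
            rw [norm_mul, Complex.norm_intCast]
            exact mul_le_mul_of_nonneg_left (H' k hk) (abs_nonneg _)
      _ = S * |c| ^ p / (p - 1)! := by rw [← sum_mul, ← hS, mul_div_assoc]
  have h1 : (1 : ℝ) ≤ ‖(M : ℂ)‖ := by
    rw [Complex.norm_intCast]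
    exact_mod_cast Int.one_le_abs hM0
  linarith [hN p hpN]

/-- **Hermite's theorem over `ℤ`** (Hermite 1873; Baker 1975, Ch. 1 Thm. 1.2): `exp 1 ∈ ℂ` is
not a root of any non-zero integer polynomial. Reduction to `aeval_cexp_one_ne_zero` by dividing
out the exact power of `X` (`exp 1 ≠ 0`). [cite: BakerTNT1975, Ch. 1 §2 Thm. 1.2] -/
theorem transcendental_int_cexp_one : Transcendental ℤ (cexp 1) := by
  rintro ⟨q, hq0, hq⟩
  obtain ⟨r, hr, hX⟩ := q.exists_eq_pow_rootMultiplicity_mul_and_not_dvd hq0 0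
  rw [C_0, sub_zero] at hr hX
  rw [X_dvd_iff] at hX
  refine aeval_cexp_one_ne_zero r hX ?_
  rw [hr, map_mul, map_pow, aeval_X, mul_eq_zero] at hq
  exact hq.resolve_left (pow_ne_zero _ (Complex.exp_ne_zero 1))

/-- **Hermite's theorem over `ℚ`** (Hermite 1873; Baker 1975, Ch. 1 Thm. 1.2): `exp 1 ∈ ℂ` is
transcendental over `ℚ` (clearing denominators, `IsFractionRing.isAlgebraic_iff`).
[cite: BakerTNT1975, Ch. 1 §2 Thm. 1.2] -/
theorem transcendental_rat_cexp_one : Transcendental ℚ (cexp 1) := fun h =>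
  transcendental_int_cexp_one ((IsFractionRing.isAlgebraic_iff ℤ ℚ ℂ).mpr h)

/-- **Hermite's theorem** (Hermite 1873; Baker 1975, Ch. 1 §2, Theorem 1.2, p. 4:
"e is transcendental") — discharge of the named fact `transcendental_exp_one` (periods.S11),
i.e. `Transcendental ℚ (Real.exp 1)`. [cite: BakerTNT1975, Ch. 1 §2 Thm. 1.2] -/
theorem transcendental_exp_one_holds : transcendental_exp_one := by
  have h := transcendental_rat_cexp_one
  rw [show cexp 1 = ((Real.exp 1 : ℝ) : ℂ) by simp [Complex.ofReal_exp]] at h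
  exact (transcendental_algebraMap_iff (A := ℂ) Complex.ofReal_injective).mp h

/-- **At least one of `e + π` and `e π` is transcendental** — discharge of the named fact
`transcendental_exp_one_add_pi_or_mul_pi` (periods.S15), a folklore consequence of Hermite's
theorem (Baker 1975, Ch. 1 §2 Thm. 1.2). Indeed `e` is a root of
`X² − (e+π) X + e π`; were both coefficients algebraic, `e` would be algebraic over the
subalgebra `Subalgebra.algebraicClosure ℚ ℝ` of real algebraic numbers, hence over `ℚ`
(`IsAlgebraic.restrictScalars`), contradicting `transcendental_exp_one_holds`.
[cite: BakerTNT1975, Ch. 1 §2 Thm. 1.2] -/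
theorem transcendental_exp_one_add_pi_or_mul_pi_holds :
    transcendental_exp_one_add_pi_or_mul_pi := by
  unfold transcendental_exp_one_add_pi_or_mul_pi
  by_contra h
  simp only [not_or, Transcendental, not_not] at h
  obtain ⟨hs, hm⟩ := h
  refine transcendental_exp_one_holds ?_
  have halg : IsAlgebraic (Subalgebra.algebraicClosure ℚ ℝ) (Real.exp 1) := by
    refine ⟨X ^ 2 - C (⟨_, hs⟩ : Subalgebra.algebraicClosure ℚ ℝ) * X +
      C (⟨_, hm⟩ : Subalgebra.algebraicClosure ℚ ℝ), Monic.ne_zero (by monicity!), ?_⟩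
    simp only [map_add, map_sub, map_mul, map_pow, aeval_X, aeval_C, Subalgebra.algebraMap_mk,
      Algebra.algebraMap_self, RingHom.id_apply]
    ring
  exact halg.restrictScalars ℚ

/-- **Ball–Rivoal: Théorème 1 implies the Corollary** (periods.S19). Rivoal states the dimension
bound as the theorem "dont découle l'irrationalité d'une infinité de `ζ(2n+1)`"
[cite: Rivoal2000, §1 (Introduction, sentence introducing Théorème 1)]; Fischler's Bourbaki report
prints the same deduction: the `ℚ`-space spanned by `1, ζ(3), ζ(5), …` is infinite-dimensional, "En
conséquence, il existe une infinité de `k` tels que `ζ(2k+1)` soit irrationnel"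
[cite: Fischler2004, Introduction, Théorème 0.3 and the sentence after it]. Proof: if only finitely
many `ζ(2k+1)` were irrational, every space `ℚ + ℚζ(3) + ⋯ + ℚζ(a')` of `ball_rivoal` would lie in
the `ℚ`-span `V` of `1` and those finitely many values (a rational `ζ(k)` is a rational multiple of
`1`), so its dimension would be at most `dim V` for every `a`, whereas `ball_rivoal` with `ε = 1/2`
makes it at least `log a / (2 (1 + log 2)) → ∞`. Hence the named fact
`infinite_setOf_irrational_zetaValue_odd` follows from the named fact `ball_rivoal`. -/
theorem ball_rivoal.infinite_setOf_irrational_zetaValue_odd (h : ball_rivoal) :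
    infinite_setOf_irrational_zetaValue_odd := by
  unfold Literature.NumberTheory.Transcendental.infinite_setOf_irrational_zetaValue_odd
  by_contra hfin
  rw [Set.not_infinite] at hfin
  -- `S`: `1` together with the finitely many irrational odd zeta values; `V = span ℚ S`
  set S : Set ℝ :=
    insert 1 ((fun k : ℕ => zetaValue (2 * k + 1)) '' {k : ℕ | Irrational (zetaValue (2 * k + 1))})
    with hS
  have hSfin : S.Finite := (hfin.image _).insert 1
  haveI : Module.Finite ℚ (Submodule.span ℚ S) := Module.Finite.span_of_finite ℚ hSfin
  have h1 : (1 : ℝ) ∈ Submodule.span ℚ S := Submodule.subset_span (Set.mem_insert _ _)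
  -- every space of `ball_rivoal` lies in `V`
  have hle : ∀ a : ℕ, Submodule.span ℚ
      (insert (1 : ℝ) {x | ∃ k : ℕ, Odd k ∧ 3 ≤ k ∧ k ≤ a ∧ x = zetaValue k}) ≤
        Submodule.span ℚ S := by
    intro a
    refine Submodule.span_le.2 ?_
    rintro x (rfl | ⟨k, hk, -, -, rfl⟩)
    · exact h1
    · obtain ⟨m, rfl⟩ := hk
      by_cases hirr : Irrational (zetaValue (2 * m + 1))
      · exact Submodule.subset_span (Set.mem_insert_of_mem _ ⟨m, hirr, rfl⟩)
      · simp only [Irrational, not_not, Set.mem_range] at hirr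
        obtain ⟨q, hq⟩ := hirr
        rw [← hq, ← Rat.smul_one_eq_cast ℝ q]
        exact Submodule.smul_mem _ q h1
  have hbound : ∀ a : ℕ,
      (Module.finrank ℚ
          ↥(Submodule.span ℚ
            (insert (1 : ℝ) {x | ∃ k : ℕ, Odd k ∧ 3 ≤ k ∧ k ≤ a ∧ x = zetaValue k})) : ℝ) ≤
        Module.finrank ℚ (Submodule.span ℚ S) := fun a => by
    exact_mod_cast Submodule.finrank_mono (hle a)
  -- Théorème 1 with `ε = 1/2`, against `log a → ∞`
  have h2 : 0 < 1 + Real.log 2 := by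
    have := Real.log_nonneg (show (1 : ℝ) ≤ 2 by norm_num)
    linarith
  have hlog : Tendsto (fun a : ℕ => (1 - 1 / 2) * Real.log a / (1 + Real.log 2)) atTop atTop := by
    refine Tendsto.atTop_div_const h2 (Tendsto.const_mul_atTop (by norm_num) ?_)
    exact Real.tendsto_log_atTop.comp tendsto_natCast_atTop_atTop
  obtain ⟨a, ha1, ha2⟩ :=
    ((h (1 / 2) (by norm_num)).and
      (hlog.eventually_gt_atTop (Module.finrank ℚ (Submodule.span ℚ S) : ℝ))).exists
  have ha3 := hbound a
  linarith

/-! ## Apéry's theorem (periods.S18)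

Discharge of `irrational_zetaValue_three`; the proof (Apéry's double table, after Apéry 1981 and
Rajkumar, arXiv:1212.5881, with an elementary growth bound in place of Poincaré–Perron and
Chebyshev's bound `lcm(1..n)³ ≤ K·32ⁿ` in place of the prime number theorem) lives in
`AperyTable.lean`, `AperyTableBounds.lean`, `../LFunctions/LcmUptoCubeBound.lean` and
`AperyIrrationality.lean`. -/

/-- **Apéry's theorem** — discharge of the named fact `irrational_zetaValue_three`
(**periods.S18**; Apéry 1979, *Astérisque* 61): `ζ(3) = ∑ n⁻³` is irrational.
See `Apery.irrational_zeta_three`. [cite: Apery1979, Astérisque 61 (Théorème)] -/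
theorem irrational_zetaValue_three_holds : irrational_zetaValue_three :=
  Apery.irrational_zeta_three

/-! ## `e + π` and `e π` (periods.S15): the open irrationality statements, what implies them,
and what is known unconditionally

`ExpOneAddPiIrrational` and `ExpOneMulPiIrrational` (`PeriodsWave0.lean`) are OPEN PROBLEMS
[Rivoal2024, §4 p. 204]. The theorems below are the complete in-tree picture: each follows from
the (open) algebraic independence of `e` and `π` — `ExpOnePiAlgebraicIndependent`, itself a
consequence of Schanuel's conjecture
(`Literature.Barriers.Schanuel.expOnePiAlgebraicIndependent_of_schanuel`) — and at least one of
the two holds. -/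

/-- If `x, y ∈ ℝ` are algebraically independent over `ℚ` then `x + y` is irrational: were
`x + y = q ∈ ℚ`, the polynomial `X₀ + X₁ − q ∈ ℚ[X₀, X₁]`, whose value at `(q + 1, 0)` is `1`,
would vanish at `(x, y)`. [folklore] -/
theorem irrational_add_of_algebraicIndependent {x y : ℝ} (h : AlgebraicIndependent ℚ ![x, y]) :
    Irrational (x + y) := by
  rintro ⟨q, hq⟩
  have hP := h.eq_zero_of_aeval_eq_zero
    (MvPolynomial.X 0 + MvPolynomial.X 1 - MvPolynomial.C q : MvPolynomial (Fin 2) ℚ)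
    (by simp [hq])
  have h1 := congrArg (MvPolynomial.eval ![q + 1, 0]) hP
  simp at h1

/-- If `x, y ∈ ℝ` are algebraically independent over `ℚ` then `x y` is irrational: were
`x y = q ∈ ℚ`, the polynomial `X₀ X₁ − q ∈ ℚ[X₀, X₁]`, whose value at `(q + 1, 1)` is `1`, would
vanish at `(x, y)`. [folklore] -/
theorem irrational_mul_of_algebraicIndependent {x y : ℝ} (h : AlgebraicIndependent ℚ ![x, y]) :
    Irrational (x * y) := by
  rintro ⟨q, hq⟩
  have hP := h.eq_zero_of_aeval_eq_zero
    (MvPolynomial.X 0 * MvPolynomial.X 1 - MvPolynomial.C q : MvPolynomial (Fin 2) ℚ)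
    (by simp [hq])
  have h1 := congrArg (MvPolynomial.eval ![q + 1, 1]) hP
  simp at h1

/-- **`e, π` algebraically independent ⟹ `e + π` is irrational.** The OPEN statement
`ExpOneAddPiIrrational` (periods.S15: "On ne sait pas montrer non plus que les nombres `e + π`
et `eπ` sont irrationnels") follows from the open conjecture `ExpOnePiAlgebraicIndependent`.
PROVED reduction; the conclusion itself has no proof in print. [cite: Rivoal2024, §4 p. 204] -/
theorem expOneAddPiIrrational_of_expOnePiAlgebraicIndependent (h : ExpOnePiAlgebraicIndependent) :
    ExpOneAddPiIrrational :=
  irrational_add_of_algebraicIndependent h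

/-- **`e, π` algebraically independent ⟹ `e π` is irrational.** The OPEN statement
`ExpOneMulPiIrrational` (periods.S15: "On ne sait pas montrer non plus que les nombres `e + π`
et `eπ` sont irrationnels") follows from the open conjecture `ExpOnePiAlgebraicIndependent`.
PROVED reduction; the conclusion itself has no proof in print. [cite: Rivoal2024, §4 p. 204] -/
theorem expOneMulPiIrrational_of_expOnePiAlgebraicIndependent (h : ExpOnePiAlgebraicIndependent) :
    ExpOneMulPiIrrational :=
  irrational_mul_of_algebraicIndependent h

/-- **At least one of `e + π` and `e π` is irrational** — the unconditional envelope of the two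
open statements of periods.S15 ("bien que l'on sache qu'au moins l'un des deux est transcendant
car `e` et `π` le sont"), from `transcendental_exp_one_add_pi_or_mul_pi_holds` (Hermite).
PROVED. [cite: Rivoal2024, §4 p. 204] -/
theorem expOneAddPiIrrational_or_expOneMulPiIrrational :
    ExpOneAddPiIrrational ∨ ExpOneMulPiIrrational :=
  Or.imp Transcendental.irrational Transcendental.irrational
    transcendental_exp_one_add_pi_or_mul_pi_holds

/-- **periods.S19-Corollary, discharged** (Rivoal 2000; Ball–Rivoal 2001 — "une infinité de valeurs
de la fonction zêta aux entiers impairs sont irrationnelles"; proved here by the elementary method of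
Zudilin 2018 / Sprang 2018 / Fischler–Sprang–Zudilin 2019, with the sampling estimates of
`OddZetaSampling.lean` in place of Sprang's Lemma 2.1, assembled in `OddZetaFinal.lean`):
the set `{k : ℕ | ζ(2k+1) ∉ ℚ}` is infinite. [cite: Sprang2018OddZeta, Corollary 3.2] -/
theorem infinite_setOf_irrational_zetaValue_odd_holds : infinite_setOf_irrational_zetaValue_odd :=
  OddZetaFinal.setOf_irrational_zetaValue_odd_infinite

end Literature.NumberTheory.Transcendental
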